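import Summits.HodgeConjecture.CorCM.IrreducibleOddWeightsRestriction
import HarnessLib

/-!
# Irreducible slots: EVERY maximal additive sub-family carries the antisymmetric span of the whole family

COR-CM (cell `pub-hodgecm2`, binder seat `b16` gen 56, count-neutral claim MAX-NONDEG (D-RANK), file F2 — abstract
`G`-set level, sequel of F1 `CorCM/IrreducibleOddWeightsRestriction`; theorems only, no definition, no named fact, no
`sorry`).  NEW as stated, hence under `Summits/`.  HONEST FRAMING: finite-dimensional linear algebra about the
Kubota–Dodson rank of families of CM types `Φ_i ⊆ E_i` (a group `G` acting slot by slot, antisymmetric spans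
`U(Φ_i)`, `U(Σ)`, `rank = dim U + 1`), read on Hodge groups of products of abelian varieties with complex
multiplication; `HC_CM` is neither used nor asserted.

A sub-family `{i // p i}` is ADDITIVE when `ext_j U(Φ_j) ≤ U(Σ|_p)` for all its slots `j` (tree:
`⟺ dim U(Σ|_p) = Σ_{p j} dim U(Φ_j)`, `⟺ rank(Σ|_p) − 1 = Σ_j (rank Φ_j − 1)`; for nondegenerate members ⟺ the
sub-family is NONDEGENERATE; on Hodge groups `Hg(∏_{p} A_j) = ∏_{p} Hg(A_j)`).  Seat gen 55 (F6
`CorCM/IrreducibleOddWeightsRankSubsetSum`) proved: if every `U(Φ_i)` is an IRREDUCIBLE `G`-module then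
`dim U(Σ) = Σ_{i∈T} dim U(Φ_i)` for SOME set of slots `T`.  This file identifies `T`:

> **Theorem** (`finrank_antiSpan_sigmaType_eq_restrict_of_maximal`, `finrank_antiSpan_sigmaType_eq_sum_of_maximal`).
> Let `{i // p i}` be an additive sub-family such that `U(Φ_i)` is irreducible for every `i` OFF `p` and NO slot
> `i₀ ∉ p` can be added keeping additivity.  Then the restriction `U(Σ) → U(Σ|_p)` is an ISOMORPHISM:
> `dim U(Σ) = dim U(Σ|_p) = Σ_{p j} dim U(Φ_j)`.  In particular (`exists_maximal_forall_map_slotExt_le`) maximal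
> additive sub-families exist, ALL of them have the same `Σ_{j} dim U(Φ_j)`, and `T` in the subset-sum theorem may be
> taken to be ANY of them.

On Hodge groups (all `A_i` with CM by fields whose odd weights are irreducible, e.g. (SC)/(IRR) fields of seat gens
54–55, any mixture of fields and degrees): **`Hg(∏_I A_i) → Hg(∏_{i∈T} A_i)` is an isogeny for EVERY maximal
sub-collection `T` such that `(A_i)_{i∈T}` is a nondegenerate family; `dim Hg(∏_I A_i) = Σ_{i∈T} dim A_i`.**

MECHANISM (§1, `exists_generated_of_not_forall_map_slotExt_le`: ONE MORE SLOT).  Let `p` be additive, `i₀ ∉ p`,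
`q = p ∪ {i₀}`, `U(Φ_{i₀})` irreducible.  The restriction `R : U(Σ|_q) ↠ U(Σ|_p)` has kernel `K` = the members of
`U(Σ|_q)` vanishing on the `p`-slots; reading `K` on the slot `i₀` embeds it equivariantly into `U(Φ_{i₀})`, so by
irreducibility `dim K ∈ {0, dim U(Φ_{i₀})}`.  If `dim K = dim U(Φ_{i₀})` then
`dim U(Σ|_q) = dim U(Σ|_p) + dim U(Φ_{i₀}) = Σ_{q j} dim U(Φ_j)` and `q` is additive.  So if `q` is NOT additive,
`dim U(Σ|_q) = dim U(Σ|_p)` and by F1 §3 the type vector `u_1(Φ_{i₀})` is an EQUIVARIANT COMBINATION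
`Σ_{p j} φ_j(u_1(Φ_j))` of the kept ones.  For a maximal additive `p` this holds for every `i₀ ∉ p`, and F1 §2
(`finrank_antiSpan_sigmaType_eq_restrict_of_generated`) gives the theorem.

## References

* [Gordon1999HodgeAVSurvey] B. B. Gordon, *A survey of the Hodge conjecture for abelian varieties*, §3 Theorem (Imai,
  Murty) with proof, 7.5–7.7 (`rank Hg` of products; exceptional classes).
* [Deligne1982HodgeCycles] P. Deligne, *Hodge cycles on abelian varieties*, LNM 900 (1982), I Ex. 3.7 (c).
* [Serre1977] J.-P. Serre, *Linear Representations of Finite Groups*, GTM 42 (1977), §1.3 Thm. 1, §2.2.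
* [MoonenZarhin1999LowDim] B. Moonen, Yu. Zarhin, *Hodge classes on abelian varieties of low dimension*, Math. Ann.
  315 (1999), §3 (3.1) (Hodge groups of products).
-/

set_option autoImplicit false

noncomputable section

open scoped BigOperators

universe u v w

namespace Summit.HodgeConjecture.CorCM.IrrOdd

open Literature.NumberTheory.ComplexMultiplication

variable {G : Type w} [Group G] {I : Type u} {E : I → Type v} [∀ i, MulAction G (E i)]

/-! ### §0 Bookkeeping: additivity along equivalent predicates; splitting a sum over `p ∪ {i₀}` -/

section Bookkeeping

variable [DecidableEq I]

/-- Additivity of a sub-family depends only on the predicate up to pointwise equivalence. [folklore] -/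
theorem forall_map_slotExt_le_congr (Φ : ∀ i, Set (E i)) {p p' : I → Prop} (hpp' : ∀ i, p i ↔ p' i)
    (hadd : ∀ j : {i // p i}, (antiSpan G (Φ j.1)).map (slotExt (E := fun j : {i // p i} => E j.1) j) ≤
      antiSpan G (sigmaType fun j : {i // p i} => Φ j.1)) :
    ∀ j : {i // p' i}, (antiSpan G (Φ j.1)).map (slotExt (E := fun j : {i // p' i} => E j.1) j) ≤
      antiSpan G (sigmaType fun j : {i // p' i} => Φ j.1) := by
  obtain rfl : p = p' := funext fun i => propext (hpp' i)
  exact hadd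

variable [Fintype I]

/-- `Σ_{q j} f(j) = Σ_{p j} f(j) + f(i₀)` for `q = p ∪ {i₀}`, `i₀ ∉ p`. [folklore] -/
theorem sum_subtype_eq_sum_subtype_add {p q : I → Prop} [DecidablePred p] [DecidablePred q] {i₀ : I}
    (hi₀ : ¬ p i₀) (hq : ∀ i, q i ↔ p i ∨ i = i₀) (f : I → ℕ) :
    ∑ j : {i // q i}, f j.1 = (∑ j : {i // p i}, f j.1) + f i₀ := by
  classical
  have hq' : ∀ i, i ∈ insert i₀ (Finset.univ.filter p) ↔ q i := fun i => by
    rw [Finset.mem_insert, Finset.mem_filter, hq]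
    constructor
    · rintro (h | ⟨-, h⟩)
      · exact Or.inr h
      · exact Or.inl h
    · rintro (h | h)
      · exact Or.inr ⟨Finset.mem_univ _, h⟩
      · exact Or.inl h
  have hp' : ∀ i, i ∈ Finset.univ.filter p ↔ p i := fun i => by simp only [Finset.mem_filter, Finset.mem_univ,
    true_and]
  rw [← Finset.sum_subtype _ hq' f, ← Finset.sum_subtype _ hp' f,
    Finset.sum_insert (fun h => hi₀ ((hp' i₀).1 h)), add_comm]

end Bookkeeping

/-! ### §0′ F1's sub-family form with the generation hypothesis slot by slot -/

section Generated

variable [DecidableEq I] [Fintype I] [∀ i, Fintype (E i)]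

omit [DecidableEq I] in
/-- **Generation off `p`, slot by slot ⟹ `dim U(Σ) = dim U(Σ|_p)`** — F1's
`finrank_antiSpan_sigmaType_eq_restrict_of_generated` with the equivariant maps supplied EXISTENTIALLY for each
dropped slot (and for any `Fintype` structure on the kept slots), the form consumed by the CM dresses.
[cite: Gordon1999HodgeAVSurvey, §3 Theorem (proof) and 7.5–7.7] -/
theorem finrank_antiSpan_sigmaType_eq_restrict_of_exists_generated (Φ : ∀ i, Set (E i)) (p : I → Prop)
    [DecidablePred p] [Fintype {i // p i}]
    (hgen : ∀ i, ¬ p i → ∃ φ : ∀ j : {i // p i}, (E j.1 → ℚ) →ₗ[ℚ] (E i → ℚ),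
      (∀ j (g : G) (f : E j.1 → ℚ), φ j (fun y => f (g • y)) = fun z => φ j f (g • z)) ∧
      antiVec (Φ i) (1 : G) = ∑ j, φ j (antiVec (Φ j.1) (1 : G))) :
    Module.finrank ℚ (antiSpan G (sigmaType Φ)) =
      Module.finrank ℚ (antiSpan G (sigmaType fun j : {i // p i} => Φ j.1)) := by
  classical
  choose φ hφ hφgen using hgen
  refine finrank_antiSpan_sigmaType_eq_restrict_of_generated Φ p
    (fun i j => if hi : p i then 0 else φ i hi j) (fun i j g f => ?_) (fun i hi => ?_)
  · by_cases hi : p i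
    · rw [dif_pos hi, LinearMap.zero_apply, LinearMap.zero_apply]
      rfl
    · rw [dif_neg hi]
      exact hφ i hi j g f
  · simp only [dif_neg hi]
    exact (hφgen i hi).trans (Finset.sum_congr (Finset.ext fun j => by simp only [Finset.mem_univ]) fun _ _ => rfl)

end Generated

/-! ### §1 One more slot: not additive ⟹ the new type vector is generated by the kept ones -/

section OneMoreSlot

variable [DecidableEq I] [Fintype I] [∀ i, Fintype (E i)]

/-- **ONE MORE SLOT.**  Let `{i // p i}` be an additive sub-family, `i₀ ∉ p`, `q ⟺ p ∨ (· = i₀)`, and let `U(Φ_{i₀})`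
be an irreducible `G`-module.  If the sub-family `q` is NOT additive, then `dim U(Σ|_q) = dim U(Σ|_p)`: adding the
slot `i₀` adds NOTHING to the antisymmetric span (the kernel of `U(Σ|_q) ↠ U(Σ|_p)` embeds equivariantly into
`U(Φ_{i₀})`; by irreducibility it is `0` — otherwise the dimension count makes `q` additive).
[cite: Serre1977, §1.3 Thm. 1 and §2.2] [cite: Gordon1999HodgeAVSurvey, §3 Theorem (proof) and 7.5–7.7] -/
theorem finrank_antiSpan_sigmaType_eq_of_not_forall_map_slotExt_le (Φ : ∀ i, Set (E i)) (p q : I → Prop)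
    [DecidablePred p] [DecidablePred q] {i₀ : I} (hi₀ : ¬ p i₀) (hq : ∀ i, q i ↔ p i ∨ i = i₀)
    (hirr : ∀ W : Submodule ℚ (E i₀ → ℚ), W ≤ antiSpan G (Φ i₀) → W ≠ ⊥ →
      (∀ (k : G) (f : E i₀ → ℚ), f ∈ W → (fun y => f (k • y)) ∈ W) → W = antiSpan G (Φ i₀))
    (hadd : ∀ j : {i // p i}, (antiSpan G (Φ j.1)).map (slotExt (E := fun j : {i // p i} => E j.1) j) ≤
      antiSpan G (sigmaType fun j : {i // p i} => Φ j.1))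
    (hnot : ¬ ∀ j : {i // q i}, (antiSpan G (Φ j.1)).map (slotExt (E := fun j : {i // q i} => E j.1) j) ≤
      antiSpan G (sigmaType fun j : {i // q i} => Φ j.1)) :
    Module.finrank ℚ (antiSpan G (sigmaType fun j : {i // q i} => Φ j.1)) =
      Module.finrank ℚ (antiSpan G (sigmaType fun j : {i // p i} => Φ j.1)) := by
  classical
  -- the `q`-family and its `p`-sub-family
  let ι : {i // p i} → {i // q i} := fun k => ⟨k.1, (hq k.1).2 (Or.inl k.2)⟩
  let j₀ : {i // q i} := ⟨i₀, (hq i₀).2 (Or.inr rfl)⟩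
  let Φq : ∀ j : {i // q i}, Set (E j.1) := fun j => Φ j.1
  set Uq : Submodule ℚ ((Σ j : {i // q i}, E j.1) → ℚ) := antiSpan G (sigmaType Φq) with hUq
  set Up : Submodule ℚ ((Σ k : {i // p i}, E k.1) → ℚ) := antiSpan G (sigmaType fun k : {i // p i} => Φ k.1)
    with hUp
  -- the restriction and its kernel
  set R : ((Σ j : {i // q i}, E j.1) → ℚ) →ₗ[ℚ] ((Σ k : {i // p i}, E k.1) → ℚ) :=
    LinearMap.funLeft ℚ ℚ (fun y : (Σ k : {i // p i}, E (ι k).1) => (⟨ι y.1, y.2⟩ : Σ j : {i // q i}, E j.1))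
    with hR
  have hrange : LinearMap.range (R ∘ₗ Uq.subtype) = Up := by
    rw [LinearMap.range_comp, Submodule.range_subtype, hR, hUq, hUp]
    exact map_funLeft_reindex_antiSpan_sigmaType (E := fun j : {i // q i} => E j.1) Φq ι
  set K : Submodule ℚ Uq := LinearMap.ker (R ∘ₗ Uq.subtype) with hK
  have hsum : Module.finrank ℚ Up + Module.finrank ℚ K = Module.finrank ℚ Uq := by
    rw [← hrange]
    exact LinearMap.finrank_range_add_finrank_ker _
  -- reading the kernel on the slot `i₀`
  let π : Uq →ₗ[ℚ] (E i₀ → ℚ) :=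
    LinearMap.funLeft ℚ ℚ (fun s : E i₀ => (⟨j₀, s⟩ : Σ j : {i // q i}, E j.1)) ∘ₗ Uq.subtype
  have hπmem : ∀ m : Uq, π m ∈ antiSpan G (Φ i₀) := fun m => by
    have h := map_funLeft_mk_antiSpan_sigmaType (G := G) Φq j₀
    have hm : π m ∈ (antiSpan G (sigmaType Φq)).map (LinearMap.funLeft ℚ ℚ (Sigma.mk j₀)) :=
      Submodule.mem_map_of_mem (by rw [← hUq]; exact m.2)
    rwa [h] at hm
  -- `π` is injective on `K`: a member of `U(Σ|_q)` vanishing on the `p`-slots and on `i₀` vanishes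
  have hπinj : ∀ m ∈ K, π m = 0 → m = 0 := by
    intro m hm hπ0
    have hm' : R (m : (Σ j : {i // q i}, E j.1) → ℚ) = 0 := hm
    apply Subtype.ext
    funext x
    obtain ⟨j, t⟩ := x
    rcases (hq j.1).1 j.2 with hj | hj
    · have := congrFun hm' ⟨⟨j.1, hj⟩, t⟩
      rw [hR, LinearMap.funLeft_apply] at this
      exact this
    · have hjj : j = j₀ := Subtype.ext hj
      subst hjj
      exact congrFun hπ0 t
  -- the image `W = π(K)` is a stable subspace of `U(Φ_{i₀})` of dimension `dim K`
  set W : Submodule ℚ (E i₀ → ℚ) := K.map π with hW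
  have hWle : W ≤ antiSpan G (Φ i₀) := by
    rintro _ ⟨m, -, rfl⟩
    exact hπmem m
  have hUqst : ∀ (g : G) (f : (Σ j : {i // q i}, E j.1) → ℚ), f ∈ Uq → (fun x => f (g • x)) ∈ Uq :=
    fun g f hf => by rw [hUq] at hf ⊢; exact comp_smul_mem_antiSpan hf g
  have hWst : ∀ (k : G) (f : E i₀ → ℚ), f ∈ W → (fun y => f (k • y)) ∈ W := by
    rintro k _ ⟨m, hm, rfl⟩
    have hm' : R (m : (Σ j : {i // q i}, E j.1) → ℚ) = 0 := hm
    refine ⟨⟨fun x => (m : (Σ j : {i // q i}, E j.1) → ℚ) (k • x), hUqst k _ m.2⟩, ?_, ?_⟩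
    · change R (fun x => (m : (Σ j : {i // q i}, E j.1) → ℚ) (k • x)) = 0
      rw [hR, funLeft_reindex_comp_smul (E := fun j : {i // q i} => E j.1) ι, ← hR, hm']
      rfl
    · funext s
      rfl
  have hWdim : Module.finrank ℚ W = Module.finrank ℚ K := by
    have hinj : Function.Injective (π ∘ₗ K.subtype) := by
      intro a b hab
      apply Subtype.ext
      have h := hπinj (a - b) (K.sub_mem a.2 b.2) (by
        rw [map_sub, sub_eq_zero]
        exact hab)
      rwa [sub_eq_zero] at h
    have hrg : LinearMap.range (π ∘ₗ K.subtype) = W := by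
      rw [LinearMap.range_comp, Submodule.range_subtype, hW]
    rw [← hrg]
    exact LinearMap.finrank_range_of_inj hinj
  -- dichotomy by irreducibility
  by_cases hW0 : W = ⊥
  · have hK0 : Module.finrank ℚ K = 0 := by rw [← hWdim, hW0, finrank_bot]
    omega
  · exfalso
    have hWeq : W = antiSpan G (Φ i₀) := hirr W hWle hW0 hWst
    -- then `q` is additive: the dimension count
    have hp : Module.finrank ℚ Up = ∑ k : {i // p i}, Module.finrank ℚ (antiSpan G (Φ k.1)) := by
      rw [hUp]
      exact (forall_map_slotExt_le_iff_finrank_antiSpan_sigmaType_eq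
        (E := fun k : {i // p i} => E k.1) fun k => Φ k.1).1 hadd
    apply hnot
    refine (forall_map_slotExt_le_iff_finrank_antiSpan_sigmaType_eq
      (E := fun j : {i // q i} => E j.1) Φq).2 ?_
    rw [← hUq, ← hsum, hp, ← hWdim, hWeq,
      sum_subtype_eq_sum_subtype_add hi₀ hq fun i => Module.finrank ℚ (antiSpan G (Φ i))]

/-- **One more slot, generation form**: under the same hypotheses the type vector of the new slot is an EQUIVARIANT
COMBINATION of the kept ones, `u_1(Φ_{i₀}) = Σ_{p j} φ_j(u_1(Φ_j))` with `G`-equivariant linear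
`φ_j : ℚ^{E_j} → ℚ^{E_{i₀}}` (F1 §3 on the restriction `U(Σ|_q) → U(Σ|_p)`, read at the slot `i₀`).
[cite: Serre1977, §1.3 Thm. 1 and §2.2] [cite: Gordon1999HodgeAVSurvey, §3 Theorem (proof) and 7.5–7.7] -/
theorem exists_generated_of_not_forall_map_slotExt_le (Φ : ∀ i, Set (E i)) (p q : I → Prop)
    [DecidablePred p] [DecidablePred q] {i₀ : I} (hi₀ : ¬ p i₀) (hq : ∀ i, q i ↔ p i ∨ i = i₀)
    (hirr : ∀ W : Submodule ℚ (E i₀ → ℚ), W ≤ antiSpan G (Φ i₀) → W ≠ ⊥ →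
      (∀ (k : G) (f : E i₀ → ℚ), f ∈ W → (fun y => f (k • y)) ∈ W) → W = antiSpan G (Φ i₀))
    (hadd : ∀ j : {i // p i}, (antiSpan G (Φ j.1)).map (slotExt (E := fun j : {i // p i} => E j.1) j) ≤
      antiSpan G (sigmaType fun j : {i // p i} => Φ j.1))
    (hnot : ¬ ∀ j : {i // q i}, (antiSpan G (Φ j.1)).map (slotExt (E := fun j : {i // q i} => E j.1) j) ≤
      antiSpan G (sigmaType fun j : {i // q i} => Φ j.1)) :
    ∃ φ : ∀ j : {i // p i}, (E j.1 → ℚ) →ₗ[ℚ] (E i₀ → ℚ),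
      (∀ j (g : G) (f : E j.1 → ℚ), φ j (fun y => f (g • y)) = fun z => φ j f (g • z)) ∧
      antiVec (Φ i₀) (1 : G) = ∑ j, φ j (antiVec (Φ j.1) (1 : G)) := by
  classical
  obtain ⟨φ, hφ, hgen⟩ := exists_generated_of_finrank_antiSpan_sigmaType_eq_reindex
    (E := fun j : {i // q i} => E j.1) (fun j => Φ j.1)
    (fun k : {i // p i} => (⟨k.1, (hq k.1).2 (Or.inl k.2)⟩ : {i // q i}))
    (finrank_antiSpan_sigmaType_eq_of_not_forall_map_slotExt_le Φ p q hi₀ hq hirr hadd hnot)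
  exact ⟨fun k => φ ⟨i₀, (hq i₀).2 (Or.inr rfl)⟩ k, fun k g f => hφ _ k g f, hgen ⟨i₀, (hq i₀).2 (Or.inr rfl)⟩⟩

end OneMoreSlot

/-! ### §2 Maximal additive sub-families carry `U(Σ)` -/

section Maximal

variable [DecidableEq I] [Fintype I] [∀ i, Fintype (E i)]

/-- **EVERY MAXIMAL ADDITIVE SUB-FAMILY CARRIES `U(Σ)`.**  If the sub-family `{i // p i}` is additive, `U(Φ_i)` is an
irreducible `G`-module for every `i` off `p`, and no slot `i₀ ∉ p` can be added keeping additivity, then the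
restriction `U(Σ) → U(Σ|_p)` is an isomorphism: `dim U(Σ) = dim U(Σ|_p)`.  On Hodge groups: `Hg(∏_I A_i) → Hg(∏_p A_j)`
is an isogeny for every maximal nondegenerate sub-collection.
[cite: Gordon1999HodgeAVSurvey, §3 Theorem (proof) and 7.5–7.7] [cite: Serre1977, §2.2] -/
theorem finrank_antiSpan_sigmaType_eq_restrict_of_maximal (Φ : ∀ i, Set (E i)) (p : I → Prop) [DecidablePred p]
    (hirr : ∀ i, ¬ p i → ∀ W : Submodule ℚ (E i → ℚ), W ≤ antiSpan G (Φ i) → W ≠ ⊥ →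
      (∀ (k : G) (f : E i → ℚ), f ∈ W → (fun y => f (k • y)) ∈ W) → W = antiSpan G (Φ i))
    (hadd : ∀ j : {i // p i}, (antiSpan G (Φ j.1)).map (slotExt (E := fun j : {i // p i} => E j.1) j) ≤
      antiSpan G (sigmaType fun j : {i // p i} => Φ j.1))
    (hmax : ∀ i₀, ¬ p i₀ → ¬ ∀ j : {i // p i ∨ i = i₀},
      (antiSpan G (Φ j.1)).map (slotExt (E := fun j : {i // p i ∨ i = i₀} => E j.1) j) ≤
        antiSpan G (sigmaType fun j : {i // p i ∨ i = i₀} => Φ j.1)) :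
    Module.finrank ℚ (antiSpan G (sigmaType Φ)) =
      Module.finrank ℚ (antiSpan G (sigmaType fun j : {i // p i} => Φ j.1)) := by
  classical
  have hgen : ∀ i₀, ¬ p i₀ → ∃ φ : ∀ j : {i // p i}, (E j.1 → ℚ) →ₗ[ℚ] (E i₀ → ℚ),
      (∀ j (g : G) (f : E j.1 → ℚ), φ j (fun y => f (g • y)) = fun z => φ j f (g • z)) ∧
      antiVec (Φ i₀) (1 : G) = ∑ j, φ j (antiVec (Φ j.1) (1 : G)) := fun i₀ hi₀ =>
    exists_generated_of_not_forall_map_slotExt_le Φ p (fun i => p i ∨ i = i₀) hi₀ (fun _ => Iff.rfl)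
      (hirr i₀ hi₀) hadd (hmax i₀ hi₀)
  choose φ hφ hφgen using hgen
  refine finrank_antiSpan_sigmaType_eq_restrict_of_generated Φ p
    (fun i j => if hi : p i then 0 else φ i hi j) (fun i j g f => ?_) (fun i hi => ?_)
  · by_cases hi : p i
    · rw [dif_pos hi, LinearMap.zero_apply, LinearMap.zero_apply]
      rfl
    · rw [dif_neg hi]
      exact hφ i hi j g f
  · simp only [dif_neg hi]
    exact hφgen i hi

/-- **`dim U(Σ) = Σ_{p j} dim U(Φ_j)` for every maximal additive sub-family `p`** (with irreducible slots off `p`).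
[cite: Gordon1999HodgeAVSurvey, §3 Theorem (proof) and 7.5–7.7] -/
theorem finrank_antiSpan_sigmaType_eq_sum_subtype_of_maximal (Φ : ∀ i, Set (E i)) (p : I → Prop)
    [DecidablePred p]
    (hirr : ∀ i, ¬ p i → ∀ W : Submodule ℚ (E i → ℚ), W ≤ antiSpan G (Φ i) → W ≠ ⊥ →
      (∀ (k : G) (f : E i → ℚ), f ∈ W → (fun y => f (k • y)) ∈ W) → W = antiSpan G (Φ i))
    (hadd : ∀ j : {i // p i}, (antiSpan G (Φ j.1)).map (slotExt (E := fun j : {i // p i} => E j.1) j) ≤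
      antiSpan G (sigmaType fun j : {i // p i} => Φ j.1))
    (hmax : ∀ i₀, ¬ p i₀ → ¬ ∀ j : {i // p i ∨ i = i₀},
      (antiSpan G (Φ j.1)).map (slotExt (E := fun j : {i // p i ∨ i = i₀} => E j.1) j) ≤
        antiSpan G (sigmaType fun j : {i // p i ∨ i = i₀} => Φ j.1)) :
    Module.finrank ℚ (antiSpan G (sigmaType Φ)) = ∑ j : {i // p i}, Module.finrank ℚ (antiSpan G (Φ j.1)) := by
  rw [finrank_antiSpan_sigmaType_eq_restrict_of_maximal Φ p hirr hadd hmax]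
  exact (forall_map_slotExt_le_iff_finrank_antiSpan_sigmaType_eq (E := fun j : {i // p i} => E j.1)
    fun j => Φ j.1).1 hadd

/-- **Finset form: `dim U(Σ) = Σ_{i∈T} dim U(Φ_i)` for every maximal additive set of slots `T`** (irreducible slots
off `T`). [cite: Gordon1999HodgeAVSurvey, §3 Theorem (proof) and 7.5–7.7] -/
theorem finrank_antiSpan_sigmaType_eq_sum_of_maximal (Φ : ∀ i, Set (E i)) (T : Finset I)
    (hirr : ∀ i, i ∉ T → ∀ W : Submodule ℚ (E i → ℚ), W ≤ antiSpan G (Φ i) → W ≠ ⊥ →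
      (∀ (k : G) (f : E i → ℚ), f ∈ W → (fun y => f (k • y)) ∈ W) → W = antiSpan G (Φ i))
    (hadd : ∀ j : {i // i ∈ T}, (antiSpan G (Φ j.1)).map (slotExt (E := fun j : {i // i ∈ T} => E j.1) j) ≤
      antiSpan G (sigmaType fun j : {i // i ∈ T} => Φ j.1))
    (hmax : ∀ i₀, i₀ ∉ T → ¬ ∀ j : {i // i ∈ T ∨ i = i₀},
      (antiSpan G (Φ j.1)).map (slotExt (E := fun j : {i // i ∈ T ∨ i = i₀} => E j.1) j) ≤
        antiSpan G (sigmaType fun j : {i // i ∈ T ∨ i = i₀} => Φ j.1)) :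
    Module.finrank ℚ (antiSpan G (sigmaType Φ)) = ∑ i ∈ T, Module.finrank ℚ (antiSpan G (Φ i)) := by
  rw [finrank_antiSpan_sigmaType_eq_sum_subtype_of_maximal Φ (· ∈ T) hirr hadd hmax]
  exact (Finset.sum_subtype T (fun _ => Iff.rfl) fun i => Module.finrank ℚ (antiSpan G (Φ i))).symm

omit [∀ i, Fintype (E i)] in
/-- **Maximal additive sets of slots exist** (the empty sub-family is additive; take one of maximal size).
[cite: Gordon1999HodgeAVSurvey, §3 Theorem (proof)] -/
theorem exists_maximal_forall_map_slotExt_le (Φ : ∀ i, Set (E i)) :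
    ∃ T : Finset I,
      (∀ j : {i // i ∈ T}, (antiSpan G (Φ j.1)).map (slotExt (E := fun j : {i // i ∈ T} => E j.1) j) ≤
        antiSpan G (sigmaType fun j : {i // i ∈ T} => Φ j.1)) ∧
      ∀ i₀, i₀ ∉ T → ¬ ∀ j : {i // i ∈ T ∨ i = i₀},
        (antiSpan G (Φ j.1)).map (slotExt (E := fun j : {i // i ∈ T ∨ i = i₀} => E j.1) j) ≤
          antiSpan G (sigmaType fun j : {i // i ∈ T ∨ i = i₀} => Φ j.1) := by
  classical
  let S : Finset (Finset I) := Finset.univ.filter fun T => ∀ j : {i // i ∈ T},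
    (antiSpan G (Φ j.1)).map (slotExt (E := fun j : {i // i ∈ T} => E j.1) j) ≤
      antiSpan G (sigmaType fun j : {i // i ∈ T} => Φ j.1)
  have hS : S.Nonempty := ⟨∅, by
    rw [Finset.mem_filter]
    exact ⟨Finset.mem_univ _, fun j => absurd j.2 (Finset.notMem_empty _)⟩⟩
  obtain ⟨T, hT, hTmax⟩ := Finset.exists_max_image S Finset.card hS
  rw [Finset.mem_filter] at hT
  refine ⟨T, hT.2, fun i₀ hi₀ hadd' => ?_⟩
  have hmem : insert i₀ T ∈ S := by
    rw [Finset.mem_filter]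
    refine ⟨Finset.mem_univ _, forall_map_slotExt_le_congr Φ (fun i => ?_) hadd'⟩
    rw [Finset.mem_insert]
    exact Or.comm
  have := hTmax _ hmem
  rw [Finset.card_insert_of_notMem hi₀] at this
  omega

/-- **THE SUBSET-SUM THEOREM WITH `T` IDENTIFIED**: if EVERY `U(Φ_i)` is irreducible, then for EVERY maximal additive
set of slots `T`, `dim U(Σ) = Σ_{i∈T} dim U(Φ_i)`; such `T` exist, and all of them give the same sum (seat gen 55 F6
`exists_finrank_antiSpan_sigmaType_eq_sum` produced some `T`).  On Hodge groups: `dim Hg(∏_I A_i) = Σ_{i∈T} dim Hg(A_i)`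
for every maximal sub-collection `T` with `Hg(∏_T A_i) = ∏_T Hg(A_i)`.
[cite: Gordon1999HodgeAVSurvey, §3 Theorem (proof) and 7.5–7.7] [cite: MoonenZarhin1999LowDim, §3 (3.1)] -/
theorem exists_maximal_finrank_antiSpan_sigmaType_eq_sum (Φ : ∀ i, Set (E i))
    (hirr : ∀ i, ∀ W : Submodule ℚ (E i → ℚ), W ≤ antiSpan G (Φ i) → W ≠ ⊥ →
      (∀ (k : G) (f : E i → ℚ), f ∈ W → (fun y => f (k • y)) ∈ W) → W = antiSpan G (Φ i)) :
    ∃ T : Finset I,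
      (∀ j : {i // i ∈ T}, (antiSpan G (Φ j.1)).map (slotExt (E := fun j : {i // i ∈ T} => E j.1) j) ≤
        antiSpan G (sigmaType fun j : {i // i ∈ T} => Φ j.1)) ∧
      (∀ i₀, i₀ ∉ T → ¬ ∀ j : {i // i ∈ T ∨ i = i₀},
        (antiSpan G (Φ j.1)).map (slotExt (E := fun j : {i // i ∈ T ∨ i = i₀} => E j.1) j) ≤
          antiSpan G (sigmaType fun j : {i // i ∈ T ∨ i = i₀} => Φ j.1)) ∧
      Module.finrank ℚ (antiSpan G (sigmaType Φ)) = ∑ i ∈ T, Module.finrank ℚ (antiSpan G (Φ i)) := by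
  obtain ⟨T, hadd, hmax⟩ := exists_maximal_forall_map_slotExt_le (G := G) Φ
  exact ⟨T, hadd, hmax, finrank_antiSpan_sigmaType_eq_sum_of_maximal Φ T (fun i _ => hirr i) hadd hmax⟩

end Maximal

end Summit.HodgeConjecture.CorCM.IrrOdd

end
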